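import Summits.CriticalPhenomena.PercolationContinuityZ3.Theorems.PercNearOneGluingNoHeavyLowerTailThreePointLBSwitchingMaps
import Summits.CriticalPhenomena.PercolationContinuityZ3.Theorems.PercNearOneGluingNoHeavyLowerTailThreePointLBSwitchingCertificate
import Literature.Probability.Percolation.SahiThreePointSeparation
import Mathlib.Tactic.Ring
import Mathlib.Tactic.Linarith
import HarnessLib

/-!
# `NoHeavyLowerTail` (stmt-CriticalPhenomena-4575) — THEOREM `3PT-LB = SHK3⁺ = Sahi's C₃ on the three pairwise
# separations ≥ 0` on EVERY finite weighted graph (four-switching proof), IV: pointwise lemma, expectation, theorem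

Support file (prover prim-cert-2; `--supports stmt-CriticalPhenomena-4575`).  No named facts, no sorries.

**Theorem** (`sahiE3_pairSep_nonneg`).  For Bernoulli bond percolation `prodBernoulli w` with arbitrary edge
weights `w : Sym2 V → [0,1]` on a finite vertex type `V` and any vertices `a b c`,
`0 ≤ E₃({a↮b},{a↮c},{b↮c})` (Sahi's third-order functional `Literature.Probability.LatticeModels.sahiE3` on the
three pairwise-separation events) — equivalently (`prodBernoulli_sahiE3_pairSep_eq`) the five-cell inequality
`(1+t)(qt − (u₃u₂ + u₃u₁ + u₂u₁)) − u₃u₂u₁ ≥ 0` (`threePointLB_prodBernoulli`; finitary form `threePointLB_PrW`),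
i.e. prove-2's `3PT-LB` `t(1+τ_ab+τ_ac+τ_bc) ≥ e₂(τ)+e₃(τ)`, = the harness row `SHK3⁺`, = the instance of
[Kahn2022, Conj. 5] / Sahi's `C₃` [Sahi2008] for pairwise separations, which the tree recorded as open
(`Literature/Probability/Percolation/SahiThreePointSeparation.lean`; conditional versions
`sahiE3_pairSep_nonneg_of_kahnConjecture`, `…_of_G3`, TSP/small-graph cases `TSP.sahiE3_pairSep_nonneg`,
`sahiE3_pairSep_nonneg_fin4`).  Here it is UNCONDITIONAL for all finite graphs.

**Proof** (prim-lit-2, PROOF-3PTLB.md, 2026-08-19 — three-copy switching certificate found by LP; this is its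
formalisation).  Three independent copies `X, Y, Z`; the four switchings `Φ₁…Φ₄` of file II
(`…ThreePointLBSwitchingMaps`: explore `K_a(X)`, `K_b(X)` and hand their pair-regions to `Y`/`Z`), each
preserving `μ^{⊗3}` [GladkovZimin2024, Lemma 4.2]; integer potentials `λ₀…λ₄` on the cells of the triple
(`cert`); POINTWISE `S = λ₀ + Σ λᵢ∘Φᵢ ≤ 0` (`cert_nonpos`: the sealed-island facts F1–F4 of file I
`…ThreePointLBSwitchingClusters` rewrite all memberships into fifteen atoms with twelve implications, and the
finite check is `certP_nonpos` of file III `…ThreePointLBSwitchingCertificate`); and `E[S] = −F`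
(`sum_wt3W_cert`: measure preservation + factorisation of box events; `cert_identity`).  Hence `F = −E[S] ≥ 0`.
What is new relative to print (lit-2): Gladkov–Zimin prove quadratic inequalities with one explored cluster and
two copies; the cubic needs two explored clusters of the same copy handed to two different copies in both orders.
-/

noncomputable section

namespace Summit.CriticalPhenomena.PercolationContinuityZ3.Theorems

namespace ThreePointLB

open Finset Literature.Probability.Percolation Literature.Probability.Percolation.DecisionTree
open Literature.Probability.Percolation.Gladkov
open scoped Classical

variable {V : Type*} [Fintype V] [DecidableEq V]

/-! ### The potentials and the pointwise certificate -/

section Cert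

variable (a b c : V)

/-- The pointwise certificate `S(x) = λ₀(x) + λ₁(Φ₁ x) + λ₂(Φ₂ x) + λ₃(Φ₃ x) + λ₄(Φ₄ x)` of PROOF-3PTLB.md, with the
integer potentials written as indicators of box events of the five three-point cells
`Q = a|b|c`, `Pa = bc|a`, `Pb = ac|b`, `T = abc` and of `{a~c}`, `{a≁c}`, `{b≁c}`, `{c≁a, c≁b}`, `{b≁a, b≁c}`:
`λ₀ = −[X∈Q] − [X∈Q][Y∈Pa][Z: a~c] + [X∈Q][Y∈T][Z: a≁c] + [X∈Pb][Y∈T][Z: a≁c]`,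
`λ₁(o) = [o₀: b≁c][o₁∈Pa][o₂: a~c]`, `λ₂(o) = [o₀: a≁c][o₁∈Pa][o₂∈Pb] − [o₁∈T][o₂∈Q]`,
`λ₃(o) = [o₁∈Pa][o₂: c≁a, c≁b]`, `λ₄(o) = [o₁: c≁a, c≁b][o₂: b≁a, b≁c]`. [folklore] -/
def cert (x : Fin 3 → Finset (Sym2 V)) : ℝ :=
  - ind (box ((conn a b)ᶜ ∩ ((conn a c)ᶜ ∩ (conn b c)ᶜ)) Set.univ Set.univ) x
  - ind (box ((conn a b)ᶜ ∩ ((conn a c)ᶜ ∩ (conn b c)ᶜ)) (conn b c ∩ (conn a b)ᶜ) (conn a c)) x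
  + ind (box ((conn a b)ᶜ ∩ ((conn a c)ᶜ ∩ (conn b c)ᶜ)) (conn a b ∩ conn a c) (conn a c)ᶜ) x
  + ind (box (conn a c ∩ (conn a b)ᶜ) (conn a b ∩ conn a c) (conn a c)ᶜ) x
  + ind (box (conn b c)ᶜ (conn b c ∩ (conn a b)ᶜ) (conn a c)) (phi1 a x)
  + ind (box (conn a c)ᶜ (conn b c ∩ (conn a b)ᶜ) (conn a c ∩ (conn a b)ᶜ)) (phi2 b x)
  - ind (box Set.univ (conn a b ∩ conn a c) ((conn a b)ᶜ ∩ ((conn a c)ᶜ ∩ (conn b c)ᶜ))) (phi2 b x)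
  + ind (box Set.univ (conn b c ∩ (conn a b)ᶜ) ((conn a c)ᶜ ∩ (conn b c)ᶜ)) (phi3 a b x)
  + ind (box Set.univ ((conn a c)ᶜ ∩ (conn b c)ᶜ) ((conn a b)ᶜ ∩ (conn b c)ᶜ)) (phi4 a b x)

end Cert

omit [Fintype V] [DecidableEq V] in
/-- `ind X x = pind (x ∈ X)`. [folklore] -/
theorem ind_eq_pind {α : Type*} (X : Set α) (x : α) : ind X x = pind (x ∈ X) := rfl

/-! ### Unconditional rewriting of connections inside the switched configurations -/

section Rewrite

variable (X ω : Finset (Sym2 V)) (v u u' : V)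

/-- (F1) `u ∈ cl (X on touch (cl X v) | ω) v ↔ u ∈ cl X v`. [folklore] -/
theorem mem_cl_splice_touch_root : u ∈ cl (splice (touch (cl X v)) X ω) v ↔ u ∈ cl X v := by
  rw [cl_splice_touch]

/-- (F1, symmetric form) `v ∈ cl (X on touch (cl X v) | ω) u ↔ v ∈ cl X u`. [folklore] -/
theorem mem_cl_splice_touch_root' : v ∈ cl (splice (touch (cl X v)) X ω) u ↔ v ∈ cl X u := by
  rw [mem_cl_comm, mem_cl_splice_touch_root, mem_cl_comm]

/-- (F1 + F2, case-free form) in `X on touch (cl X v) | ω`, `u ~ u'` iff either both lie in `cl X v`, or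
`u ∉ cl X v` and `u'` is reached from `u` by `ω`-pairs not meeting `cl X v`. [folklore] -/
theorem mem_cl_splice_touch_iff :
    u' ∈ cl (splice (touch (cl X v)) X ω) u ↔
      (u ∈ cl X v ∧ u' ∈ cl X v) ∨ (u ∉ cl X v ∧ u' ∈ cl (ω \ touch (cl X v)) u) := by
  by_cases hu : u ∈ cl X v
  · rw [mem_cl_splice_touch_iff_of_mem hu]
    simp [hu]
  · rw [mem_cl_splice_touch_iff_of_not_mem hu]
    simp [hu]

end Rewrite

/-! ### The pointwise lemma -/

/-- **Pointwise lemma** (PROOF-3PTLB.md, Lemma 2): for every graph and every triple of configurations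
`x = (X, Y, Z)`, `S(x) = λ₀(x) + Σᵢ λᵢ(Φᵢ x) ≤ 0`.  Proof: the memberships of the outputs in the cells are
rewritten with F1/F2 into fifteen atomic connection statements, F3/F4 and cluster transitivity give twelve
implications between them, and `certP_nonpos` is the remaining finite check. [folklore] -/
theorem cert_nonpos (a b c : V) (x : Fin 3 → Finset (Sym2 V)) : cert a b c x ≤ 0 := by
  have hba : ∀ K : Finset (Sym2 V), a ∈ cl K b ↔ b ∈ cl K a := fun K => mem_cl_comm
  simp only [cert, ind_eq_pind, mem_box, phi1_zero, phi1_one, phi1_two, phi2_zero, phi2_one, phi2_two,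
    phi3_zero, phi3_one, phi3_two, phi4_zero, phi4_one, phi4_two, Set.mem_inter_iff, Set.mem_compl_iff,
    Set.mem_univ, true_and, and_true, mem_conn_iff_mem_cl, mem_cl_splice_touch_root, mem_cl_splice_touch_root']
  simp only [mem_cl_splice_touch_iff, hba]
  -- the twelve implications
  refine certP_nonpos _ _ _ _ _ _ _ _ _ _ _ _ _ _ _ ?_ ?_ ?_ ?_ ?_ ?_ ?_ ?_ ?_ ?_ ?_ ?_
  · exact fun hac hbc => mem_cl_trans hac (mem_cl_comm.1 hbc)
  · exact fun hab hbc => mem_cl_trans hab hbc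
  · exact fun h => cl_mono Finset.sdiff_subset a h
  · exact fun h => cl_mono Finset.sdiff_subset b h
  · exact fun hab hbc h => not_mem_of_mem_cl_sdiff_touch (fun h' => hab ((hba _).1 h')) h hbc
  · exact fun hab hac h => not_mem_of_mem_cl_sdiff_touch hab h hac
  · exact fun hab hbc => cl_subset_cl_splice_touch_of_not_mem hab hbc
  · exact fun hab hac => cl_subset_cl_splice_touch_of_not_mem (fun h' => hab ((hba _).1 h')) hac
  · exact fun h => cl_sdiff_touch_subset_cl_splice Finset.sdiff_subset a h
  · exact fun hab hbc => cl_subset_cl_splice_sdiff hab (x 2) hbc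
  · exact fun h => cl_sdiff_touch_subset_cl_splice Finset.sdiff_subset b h
  · exact fun hab hac => cl_subset_cl_splice_sdiff (fun h' => hab ((hba _).1 h')) (x 1) hac


/-! ### The expectation of the certificate is `−F` -/

section Expectation

variable (p : Sym2 V → ℝ) (D : Finset (Sym2 V)) (a b c : V)

/-- `E[S] = Σ_i E[λ_i]`, each `E[λ_i ∘ Φ_i] = E[λ_i]` by measure preservation and each `E[λ_i]` a product of
three `PrW`'s. [folklore] -/
theorem sum_wt3W_cert :
    ∑ x ∈ triples D, wt3W D p x * cert a b c x =
      - (PrW D p ((conn a b)ᶜ ∩ ((conn a c)ᶜ ∩ (conn b c)ᶜ)) * PrW D p Set.univ * PrW D p Set.univ)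
      - PrW D p ((conn a b)ᶜ ∩ ((conn a c)ᶜ ∩ (conn b c)ᶜ)) * PrW D p (conn b c ∩ (conn a b)ᶜ) *
          PrW D p (conn a c)
      + PrW D p ((conn a b)ᶜ ∩ ((conn a c)ᶜ ∩ (conn b c)ᶜ)) * PrW D p (conn a b ∩ conn a c) *
          PrW D p (conn a c)ᶜ
      + PrW D p (conn a c ∩ (conn a b)ᶜ) * PrW D p (conn a b ∩ conn a c) * PrW D p (conn a c)ᶜ
      + PrW D p (conn b c)ᶜ * PrW D p (conn b c ∩ (conn a b)ᶜ) * PrW D p (conn a c)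
      + PrW D p (conn a c)ᶜ * PrW D p (conn b c ∩ (conn a b)ᶜ) * PrW D p (conn a c ∩ (conn a b)ᶜ)
      - PrW D p Set.univ * PrW D p (conn a b ∩ conn a c) * PrW D p ((conn a b)ᶜ ∩ ((conn a c)ᶜ ∩ (conn b c)ᶜ))
      + PrW D p Set.univ * PrW D p (conn b c ∩ (conn a b)ᶜ) * PrW D p ((conn a c)ᶜ ∩ (conn b c)ᶜ)
      + PrW D p Set.univ * PrW D p ((conn a c)ᶜ ∩ (conn b c)ᶜ) * PrW D p ((conn a b)ᶜ ∩ (conn b c)ᶜ) := by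
  have h1 : ∀ E₀ E₁ E₂ : Set (Finset (Sym2 V)),
      ∑ x ∈ triples D, wt3W D p x * ind (box E₀ E₁ E₂) (phi1 a x) = PrW D p E₀ * PrW D p E₁ * PrW D p E₂ :=
    fun E₀ E₁ E₂ => by rw [sum_wt3W_phi1 p D a (ind (box E₀ E₁ E₂)), sum_wt3W_ind_box]
  have h2 : ∀ E₀ E₁ E₂ : Set (Finset (Sym2 V)),
      ∑ x ∈ triples D, wt3W D p x * ind (box E₀ E₁ E₂) (phi2 b x) = PrW D p E₀ * PrW D p E₁ * PrW D p E₂ :=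
    fun E₀ E₁ E₂ => by rw [sum_wt3W_phi2 p D b (ind (box E₀ E₁ E₂)), sum_wt3W_ind_box]
  have h3 : ∀ E₀ E₁ E₂ : Set (Finset (Sym2 V)),
      ∑ x ∈ triples D, wt3W D p x * ind (box E₀ E₁ E₂) (phi3 a b x) = PrW D p E₀ * PrW D p E₁ * PrW D p E₂ :=
    fun E₀ E₁ E₂ => by rw [sum_wt3W_phi3 p D a b (ind (box E₀ E₁ E₂)), sum_wt3W_ind_box]
  have h4 : ∀ E₀ E₁ E₂ : Set (Finset (Sym2 V)),
      ∑ x ∈ triples D, wt3W D p x * ind (box E₀ E₁ E₂) (phi4 a b x) = PrW D p E₀ * PrW D p E₁ * PrW D p E₂ :=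
    fun E₀ E₁ E₂ => by rw [sum_wt3W_phi4 p D a b (ind (box E₀ E₁ E₂)), sum_wt3W_ind_box]
  simp only [cert, mul_add, mul_sub, mul_neg, Finset.sum_add_distrib, Finset.sum_sub_distrib,
    Finset.sum_neg_distrib, sum_wt3W_ind_box, h1, h2, h3, h4]

end Expectation

/-! ### The theorem at the finitary level -/

section Main

variable {p : Sym2 V → ℝ} (hp0 : ∀ i, 0 ≤ p i) (hp1 : ∀ i, p i ≤ 1) (D : Finset (Sym2 V)) (a b c : V)
include hp0 hp1

/-- **3PT-LB = SHK3⁺ at the finitary level.**  For every finite vertex type, every set `D` of coordinates with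
probabilities `p ∈ [0,1]`, and all `a b c`, writing `t = P(abc)`, `q = P(a|b|c)`, `u_c = P(ab|c)`,
`u_b = P(ac|b)`, `u_a = P(bc|a)`:  `(1 + t)(qt − (u_cu_b + u_cu_a + u_bu_a)) − u_cu_bu_a ≥ 0`.
Proof: `0 ≥ E[S] = −F` (`cert_nonpos`, `sum_wt3W_cert`, `cert_identity`).  Source: prim-lit-2, PROOF-3PTLB.md
(four-switching certificate, 2026). [folklore] -/
theorem threePointLB_PrW :
    0 ≤ (1 + PrW D p (conn a b ∩ conn a c)) *
          (PrW D p ((conn a b)ᶜ ∩ ((conn a c)ᶜ ∩ (conn b c)ᶜ)) * PrW D p (conn a b ∩ conn a c) -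
            (PrW D p (conn a b ∩ (conn a c)ᶜ) * PrW D p (conn a c ∩ (conn a b)ᶜ) +
              PrW D p (conn a b ∩ (conn a c)ᶜ) * PrW D p (conn b c ∩ (conn a b)ᶜ) +
              PrW D p (conn a c ∩ (conn a b)ᶜ) * PrW D p (conn b c ∩ (conn a b)ᶜ))) -
        PrW D p (conn a b ∩ (conn a c)ᶜ) * PrW D p (conn a c ∩ (conn a b)ᶜ) *
          PrW D p (conn b c ∩ (conn a b)ᶜ) := by
  -- transitivity of connection, at the level of events
  have t1 : ∀ K : Finset (Sym2 V), K ∈ conn a c → K ∈ conn b c → K ∈ conn a b :=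
    fun K hac hbc => mem_conn.2 ((mem_conn.1 hac).trans (mem_conn.1 hbc).symm)
  have t2 : ∀ K : Finset (Sym2 V), K ∈ conn a b → K ∈ conn b c → K ∈ conn a c :=
    fun K hab hbc => mem_conn.2 ((mem_conn.1 hab).trans (mem_conn.1 hbc))
  have t3 : ∀ K : Finset (Sym2 V), K ∈ conn a b → K ∈ conn a c → K ∈ conn b c :=
    fun K hab hac => mem_conn.2 ((mem_conn.1 hab).symm.trans (mem_conn.1 hac))
  -- the linear relations among the eleven events
  have R1 : PrW D p (conn a c) = PrW D p (conn a c ∩ (conn a b)ᶜ) + PrW D p (conn a b ∩ conn a c) := by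
    rw [← PrW_union D p]
    · refine PrW_congr_set D p fun K _ => ?_
      simp only [Set.mem_union, Set.mem_inter_iff, Set.mem_compl_iff]
      tauto
    · exact Set.disjoint_left.2 fun K h1 h2 => h1.2 h2.1
  have R2 : PrW D p (conn a c)ᶜ = PrW D p ((conn a b)ᶜ ∩ ((conn a c)ᶜ ∩ (conn b c)ᶜ)) +
      PrW D p (conn b c ∩ (conn a b)ᶜ) + PrW D p (conn a b ∩ (conn a c)ᶜ) := by
    rw [← PrW_union D p, ← PrW_union D p]
    · refine PrW_congr_set D p fun K _ => ?_
      simp only [Set.mem_union, Set.mem_inter_iff, Set.mem_compl_iff]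
      have := t1 K; tauto
    · exact Set.disjoint_left.2 fun K h1 h2 => by
        rcases h1 with h1 | h1
        · exact h1.1 h2.1
        · exact h1.2 h2.1
    · exact Set.disjoint_left.2 fun K h1 h2 => h1.2.2 h2.1
  have R3 : PrW D p (conn b c)ᶜ = PrW D p ((conn a b)ᶜ ∩ ((conn a c)ᶜ ∩ (conn b c)ᶜ)) +
      PrW D p (conn a c ∩ (conn a b)ᶜ) + PrW D p (conn a b ∩ (conn a c)ᶜ) := by
    rw [← PrW_union D p, ← PrW_union D p]
    · refine PrW_congr_set D p fun K _ => ?_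
      simp only [Set.mem_union, Set.mem_inter_iff, Set.mem_compl_iff]
      have := t1 K; have := t2 K; have := t3 K; tauto
    · exact Set.disjoint_left.2 fun K h1 h2 => by
        rcases h1 with h1 | h1
        · exact h1.1 h2.1
        · exact h1.2 h2.1
    · exact Set.disjoint_left.2 fun K h1 h2 => h1.2.1 h2.1
  have R4 : PrW D p ((conn a c)ᶜ ∩ (conn b c)ᶜ) = PrW D p ((conn a b)ᶜ ∩ ((conn a c)ᶜ ∩ (conn b c)ᶜ)) +
      PrW D p (conn a b ∩ (conn a c)ᶜ) := by
    rw [← PrW_union D p]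
    · refine PrW_congr_set D p fun K _ => ?_
      simp only [Set.mem_union, Set.mem_inter_iff, Set.mem_compl_iff]
      have := t2 K; tauto
    · exact Set.disjoint_left.2 fun K h1 h2 => h1.1 h2.1
  have R5 : PrW D p ((conn a b)ᶜ ∩ (conn b c)ᶜ) = PrW D p ((conn a b)ᶜ ∩ ((conn a c)ᶜ ∩ (conn b c)ᶜ)) +
      PrW D p (conn a c ∩ (conn a b)ᶜ) := by
    rw [← PrW_union D p]
    · refine PrW_congr_set D p fun K _ => ?_
      simp only [Set.mem_union, Set.mem_inter_iff, Set.mem_compl_iff]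
      have := t1 K; tauto
    · exact Set.disjoint_left.2 fun K h1 h2 => h1.2.1 h2.1
  have R6 : PrW D p (conn a c) + PrW D p (conn a c)ᶜ = 1 := by
    rw [← PrW_union D p, Set.union_compl_self, PrW_univ]
    exact Set.disjoint_left.2 fun K h1 h2 => h2 h1
  have hU : PrW D p (Set.univ : Set (Finset (Sym2 V))) = 1 := PrW_univ D p
  -- E[S] ≤ 0
  have hle : ∑ x ∈ triples D, wt3W D p x * cert a b c x ≤ 0 :=
    Finset.sum_nonpos fun x _ =>
      mul_nonpos_of_nonneg_of_nonpos (DTree3.wt3W_nonneg D hp0 hp1 x) (cert_nonpos a b c x)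
  rw [sum_wt3W_cert, R1, R2, R3, R4, R5, hU] at hle
  set q := PrW D p ((conn a b)ᶜ ∩ ((conn a c)ᶜ ∩ (conn b c)ᶜ))
  set t := PrW D p (conn a b ∩ conn a c)
  set uc := PrW D p (conn a b ∩ (conn a c)ᶜ)
  set ub := PrW D p (conn a c ∩ (conn a b)ᶜ)
  set ua := PrW D p (conn b c ∩ (conn a b)ᶜ)
  have hsum : q + ua + ub + uc + t = 1 := by linarith
  rw [cert_identity q ua ub uc t hsum] at hle
  linarith

end Main

end ThreePointLB

/-! ### The theorem for `prodBernoulli w`: Sahi's `E₃ ≥ 0` on the three pairwise separations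

(Stated for `[Finite V]`, outside the scope of the explicit `[Fintype V] [DecidableEq V]` variables of the
finitary sections, so that the `Fintype (Sym2 V)` / `DecidableEq (Sym2 V)` instances inside the proof are the
classical ones of `prodBernoulli_real_eq_PrW_univ`.) -/

namespace ThreePointLB

section Measure

open Finset Literature.Probability.Percolation Literature.Probability.Percolation.DecisionTree
open Literature.Probability.Percolation.Gladkov
open MeasureTheory Literature.Probability.LatticeModels
open scoped Classical

variable {V : Type*} [Finite V]

/-- **THEOREM (3PT-LB = SHK3⁺ = Sahi's `C₃` on the pairwise separations), every finite weighted graph.**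
For Bernoulli bond percolation `prodBernoulli w` with arbitrary edge weights on a finite vertex type and any
three vertices `a b c`:
`0 ≤ E₃({a↮b},{a↮c},{b↮c}) = 2μ(ABC) + μ(A)μ(B)μ(C) − μ(A)μ(BC) − μ(B)μ(AC) − μ(C)μ(AB)`
— the instance of [Kahn2022, Conjecture 5] / Sahi's `C₃` for the three pairwise-separation events, equivalently
prove-2's `3PT-LB`: `t(1 + τ_ab + τ_ac + τ_bc) ≥ e₂(τ) + e₃(τ)`, equivalently `SHK3⁺ = (1+t)(qt − e₂(u)) − e₃(u) ≥ 0`.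
Source of the proof: prim-lit-2, PROOF-3PTLB.md (2026-08-19): four three-copy switchings rooted in one copy,
an integer certificate and the pointwise Lemma 2; this file is its formalisation. [folklore] -/
theorem sahiE3_pairSep_nonneg (w : Sym2 V → unitInterval) (a b c : V) :
    0 ≤ sahiE3 (prodBernoulli w) (openConn a b)ᶜ (openConn a c)ᶜ (openConn b c)ᶜ := by
  obtain ⟨_instV⟩ := nonempty_fintype V
  have hp0 : ∀ e, 0 ≤ (w e : ℝ) := fun e => (w e).2.1
  have hp1 : ∀ e, (w e : ℝ) ≤ 1 := fun e => (w e).2.2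
  have key := threePointLB_PrW (p := fun e => (w e : ℝ)) hp0 hp1 Finset.univ a b c
  have hco : ∀ (S : Finset (Sym2 V)) (u v : V),
      (↑S : Set (Sym2 V)) ∈ openConn u v ↔ (openGraph (↑S : Set (Sym2 V))).Reachable u v :=
    fun _ _ _ => Iff.rfl
  have e1 : (prodBernoulli w).real (openConn a b ∩ openConn a c) =
      PrW Finset.univ (fun e => (w e : ℝ)) (conn a b ∩ conn a c) :=
    prodBernoulli_real_eq_PrW_univ w fun S => by simp only [Set.mem_inter_iff, mem_conn, hco]
  have e2 : (prodBernoulli w).real ((openConn a b)ᶜ ∩ (openConn a c)ᶜ ∩ (openConn b c)ᶜ) =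
      PrW Finset.univ (fun e => (w e : ℝ)) ((conn a b)ᶜ ∩ ((conn a c)ᶜ ∩ (conn b c)ᶜ)) :=
    prodBernoulli_real_eq_PrW_univ w fun S => by
      simp only [Set.mem_inter_iff, Set.mem_compl_iff, mem_conn, hco, and_assoc]
  have e3 : (prodBernoulli w).real (openConn a b ∩ (openConn a c)ᶜ) =
      PrW Finset.univ (fun e => (w e : ℝ)) (conn a b ∩ (conn a c)ᶜ) :=
    prodBernoulli_real_eq_PrW_univ w fun S => by simp only [Set.mem_inter_iff, Set.mem_compl_iff, mem_conn, hco]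
  have e4 : (prodBernoulli w).real (openConn a c ∩ (openConn a b)ᶜ) =
      PrW Finset.univ (fun e => (w e : ℝ)) (conn a c ∩ (conn a b)ᶜ) :=
    prodBernoulli_real_eq_PrW_univ w fun S => by simp only [Set.mem_inter_iff, Set.mem_compl_iff, mem_conn, hco]
  have e5 : (prodBernoulli w).real (openConn b c ∩ (openConn a b)ᶜ) =
      PrW Finset.univ (fun e => (w e : ℝ)) (conn b c ∩ (conn a b)ᶜ) :=
    prodBernoulli_real_eq_PrW_univ w fun S => by simp only [Set.mem_inter_iff, Set.mem_compl_iff, mem_conn, hco]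
  rw [prodBernoulli_sahiE3_pairSep_eq, e1, e2, e3, e4, e5]
  exact key

/-- **The five-cell form** for `prodBernoulli w`: with `t = μ(ab ∩ ac)`, `q = μ(a|b|c)`, `u₃ = μ(ab|c)`,
`u₂ = μ(ac|b)`, `u₁ = μ(a|bc)`: `0 ≤ (1 + t)(qt − (u₃u₂ + u₃u₁ + u₂u₁)) − u₃u₂u₁`. [folklore] -/
theorem threePointLB_prodBernoulli (w : Sym2 V → unitInterval) (a b c : V) :
    0 ≤ (1 + (prodBernoulli w).real (openConn a b ∩ openConn a c)) *
          ((prodBernoulli w).real ((openConn a b)ᶜ ∩ (openConn a c)ᶜ ∩ (openConn b c)ᶜ) *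
              (prodBernoulli w).real (openConn a b ∩ openConn a c) -
            ((prodBernoulli w).real (openConn a b ∩ (openConn a c)ᶜ) *
                (prodBernoulli w).real (openConn a c ∩ (openConn a b)ᶜ) +
              (prodBernoulli w).real (openConn a b ∩ (openConn a c)ᶜ) *
                (prodBernoulli w).real (openConn b c ∩ (openConn a b)ᶜ) +
              (prodBernoulli w).real (openConn a c ∩ (openConn a b)ᶜ) *
                (prodBernoulli w).real (openConn b c ∩ (openConn a b)ᶜ))) -
        (prodBernoulli w).real (openConn a b ∩ (openConn a c)ᶜ) *
          (prodBernoulli w).real (openConn a c ∩ (openConn a b)ᶜ) *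
          (prodBernoulli w).real (openConn b c ∩ (openConn a b)ᶜ) := by
  rw [← prodBernoulli_sahiE3_pairSep_eq]
  exact sahiE3_pairSep_nonneg w a b c

end Measure

end ThreePointLB

end Summit.CriticalPhenomena.PercolationContinuityZ3.Theorems

end
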